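import Summits.ResolutionOfSingularities.ResolutionOfSingularities.Theorems.FrobeniusLadderFRationalResolutionPointBlowupEtale
import Summits.ResolutionOfSingularities.ResolutionOfSingularities.Theorems.FrobeniusLadderFRationalResolutionVeroneseSingularLocus
import HarnessLib

/-!
# Crux `FrobeniusLadder.FRationalResolution` (stmt-ResolutionOfSingularities-15317), line `redirect`,
# stub `stub_diagonalizableQuotientResolution` — ÉTALE Veronese-cone singularities are resolvable (all dims, all fields)

Capstone of the T3 chain: `…VeroneseStalks.lean` (g0) resolved varieties whose isolated singular GERMS are Zariski
`k`-isomorphic to the vertex of a Veronese cone `V(n,r) = 𝔸ⁿ/μ_r` (weights `(1,…,1)`); here the hypothesis is weakened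
to an ÉTALE (flat, finitely presented, fibre reduced at the vertex) chart by the Veronese cone with ARBITRARY residue
field extension — the shape of the endgame stub's `hq` — using that the vertex is resolved by ONE blow-up of the
point (`veroneseCone_isRegular_affineBlowup`) and that point blow-ups descend along any such chart
(`…PointBlowupEtale.lean`).

* `exists_sub_algebraMap_mem_vertexIdeal`, `vertexIdeal_ne_top`, `vertexIdeal_isMaximal` — the vertex ideal
  `VM = (χᵈ : |d| = r)` of the Veronese ring is maximal with residue field `k` (`r ≥ 1`);
* **`hasResolution_of_veronese_flat_charts`** — an integral `X` locally of finite type over any field `k` with finitely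
  many singular points, each the image `ι 𝔭` of a maximal ideal of an affine open `Spec B ↪ X` carrying a flat finitely
  presented chart `B → k[χᵈ : |d| = r]` (`n, r ≥ 2`) with `𝔭 ↦` vertex and reduced vertex fibre over some `D(g)`, HAS A
  RESOLUTION OF SINGULARITIES.

Honest label: assembly (no stub closed by name: the stub's charts are étale MORPHISMS `Spec S₀ → X`; extracting the
ring map over an affine open is left to the consumer). No definitions, no named facts, no sorry.
[folklore; cite: Kollar2007, §2.2]
-/

noncomputable section

-- single-problem summit: the doubled namespace component is forced
set_option linter.dupNamespace false

open CategoryTheory AlgebraicGeometry TopologicalSpace MvPolynomial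
open Literature.AlgebraicGeometry.Resolution

namespace Summit.ResolutionOfSingularities.ResolutionOfSingularities.Theorems.FRationalResolution

section Cones

variable (k : Type) [Field k]

/-- The polynomial ring in `n` variables. -/
local notation3 "MP[" n "]" => MvPolynomial (Fin n) k

/-- The `r`-th Veronese subring of `k[x₁,…,xₙ]`: the `k`-subalgebra generated by the degree-`r` monomials. -/
local notation3 "VR[" n ", " r "]" =>
  Algebra.adjoin k ((fun d : Fin n →₀ ℕ => MvPolynomial.monomial d (1 : k)) ''
    {d : Fin n →₀ ℕ | Finsupp.degree d = (r : ℕ)})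

/-- The vertex ideal of the Veronese cone: spanned by the degree-`r` monomials. -/
local notation3 "VM[" n ", " r "]" =>
  Ideal.span {v : ↥VR[n, r] | ∃ d : Fin n →₀ ℕ, Finsupp.degree d = (r : ℕ) ∧
    (v : MvPolynomial (Fin n) k) = MvPolynomial.monomial d 1}

namespace VeroneseEtale

/-- **Every element of the Veronese ring is a scalar modulo the vertex ideal.** [folklore] -/
theorem exists_sub_algebraMap_mem_vertexIdeal (n r : ℕ) (v : ↥VR[n, r]) :
    ∃ c : k, v - algebraMap k ↥VR[n, r] c ∈ VM[n, r] := by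
  obtain ⟨x, hx⟩ := v
  induction hx using Algebra.adjoin_induction with
  | mem x hx =>
    obtain ⟨d, hd, rfl⟩ := hx
    refine ⟨0, ?_⟩
    rw [map_zero, sub_zero]
    exact Ideal.subset_span ⟨d, hd, rfl⟩
  | algebraMap c =>
    refine ⟨c, ?_⟩
    have : (⟨algebraMap k MP[n] c, Subalgebra.algebraMap_mem _ c⟩ : ↥VR[n, r]) =
        algebraMap k ↥VR[n, r] c := Subtype.ext rfl
    rw [this, sub_self]
    exact Ideal.zero_mem _
  | add x y hx hy ihx ihy =>
    obtain ⟨c₁, h₁⟩ := ihx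
    obtain ⟨c₂, h₂⟩ := ihy
    refine ⟨c₁ + c₂, ?_⟩
    have : (⟨x + y, add_mem hx hy⟩ : ↥VR[n, r]) - algebraMap k ↥VR[n, r] (c₁ + c₂) =
        ((⟨x, hx⟩ : ↥VR[n, r]) - algebraMap k ↥VR[n, r] c₁) + (⟨y, hy⟩ - algebraMap k ↥VR[n, r] c₂) := by
      rw [map_add]
      apply Subtype.ext
      simp only [Subalgebra.coe_sub, Subalgebra.coe_add]
      ring
    rw [this]
    exact Ideal.add_mem _ h₁ h₂
  | mul x y hx hy ihx ihy =>
    obtain ⟨c₁, h₁⟩ := ihx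
    obtain ⟨c₂, h₂⟩ := ihy
    refine ⟨c₁ * c₂, ?_⟩
    have : (⟨x * y, mul_mem hx hy⟩ : ↥VR[n, r]) - algebraMap k ↥VR[n, r] (c₁ * c₂) =
        (⟨x, hx⟩ : ↥VR[n, r]) * (⟨y, hy⟩ - algebraMap k ↥VR[n, r] c₂) +
          ((⟨x, hx⟩ : ↥VR[n, r]) - algebraMap k ↥VR[n, r] c₁) * algebraMap k ↥VR[n, r] c₂ := by
      rw [map_mul]
      apply Subtype.ext
      simp only [Subalgebra.coe_sub, Subalgebra.coe_add, Subalgebra.coe_mul]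
      ring
    rw [this]
    exact Ideal.add_mem _ (Ideal.mul_mem_left _ _ h₂) (Ideal.mul_mem_right _ _ h₁)

/-- The vertex ideal is proper for `r ≥ 1` (its elements have vanishing constant coefficient). [folklore] -/
theorem vertexIdeal_ne_top (n r : ℕ) (hr : 1 ≤ r) : VM[n, r] ≠ ⊤ := by
  -- the ideal of elements with vanishing constant coefficient contains `VM` but not `1`
  let cc : ↥VR[n, r] →+* k := (MvPolynomial.constantCoeff : MP[n] →+* k).comp (VR[n, r]).val.toRingHom
  have hle : VM[n, r] ≤ RingHom.ker cc := by
    rw [Ideal.span_le]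
    rintro v ⟨d, hd, hv⟩
    rw [SetLike.mem_coe, RingHom.mem_ker]
    change MvPolynomial.constantCoeff (v : MP[n]) = 0
    rw [hv, MvPolynomial.constantCoeff_monomial]
    have hd0 : d ≠ 0 := by
      intro h0
      rw [h0, map_zero] at hd
      omega
    exact if_neg hd0
  intro htop
  have h1 : (1 : ↥VR[n, r]) ∈ RingHom.ker cc := hle (htop ▸ Submodule.mem_top)
  rw [RingHom.mem_ker, map_one] at h1
  exact one_ne_zero h1

/-- **The vertex ideal of the Veronese ring is maximal** (`r ≥ 1`), with residue field `k`. [folklore] -/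
theorem vertexIdeal_isMaximal (n r : ℕ) (hr : 1 ≤ r) : (VM[n, r]).IsMaximal := by
  rw [Ideal.isMaximal_iff]
  refine ⟨fun h1 => vertexIdeal_ne_top k n r hr ((Ideal.eq_top_iff_one _).mpr h1), ?_⟩
  intro J x hJ hx hxJ
  obtain ⟨c, hc⟩ := exists_sub_algebraMap_mem_vertexIdeal k n r x
  have hc0 : c ≠ 0 := by
    intro h0
    rw [h0, map_zero, sub_zero] at hc
    exact hx hc
  have hcJ : algebraMap k ↥VR[n, r] c ∈ J := by
    have := J.sub_mem hxJ (hJ hc)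
    rwa [sub_sub_cancel] at this
  have hunit : IsUnit (algebraMap k ↥VR[n, r] c) := (IsUnit.mk0 c hc0).map _
  exact J.eq_top_of_isUnit_mem hcJ hunit ▸ Submodule.mem_top

/-- **VARIETIES WITH ÉTALE VERONESE-CONE SINGULARITIES ARE RESOLVABLE (every dimension, every field, any residue
fields).** Let `X` be an integral `k`-scheme locally of finite type with finitely many singular points, each of the
form `ι 𝔭` for an affine open `ι : Spec B → X` over `k` (`B` a domain of finite type over `k`, `𝔭` maximal `≠ 0`,
`Spec B ∖ {𝔭}` regular) carrying a FLAT finitely presented chart `B → k[χᵈ : |d| = r]` (`n, r ≥ 2`) with `𝔭` under the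
vertex and reduced vertex fibre over some `D(g)` (`VM·VR_g ≤ 𝔭·VR_g`, e.g. the chart is étale at the vertex). Then `X`
has a resolution of singularities. [cite: Kollar2007, §2.2] -/
theorem hasResolution_of_veronese_flat_charts (X : Scheme.{0}) [IsIntegral X] (f : X ⟶ Spec (.of k))
    [LocallyOfFiniteType f] (hfin : (Scheme.regularLocus X)ᶜ.Finite)
    (hchart : ∀ s : X, s ∉ Scheme.regularLocus X →
      ∃ (n r : ℕ) (_ : 2 ≤ n) (_ : 2 ≤ r) (B : Type) (_ : CommRing B) (_ : IsDomain B) (_ : Algebra k B)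
        (_ : Algebra.FiniteType k B) (_ : Algebra B ↥VR[n, r]) (_ : Module.Flat B ↥VR[n, r])
        (_ : Algebra.FinitePresentation B ↥VR[n, r])
        (ι : Spec (.of B) ⟶ X) (_ : IsOpenImmersion ι)
        (_ : ι ≫ f = Spec.map (CommRingCat.ofHom (algebraMap k B)))
        (𝔭 : Ideal B) (h𝔭 : 𝔭.IsMaximal) (_ : 𝔭 ≠ ⊥) (_ : ι ⟨𝔭, h𝔭.isPrime⟩ = s)
        (_ : ∀ P : Spec (.of B), P.asIdeal ≠ 𝔭 → P ∈ Scheme.regularLocus (Spec (.of B)))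
        (g : ↥VR[n, r]) (_ : g ∉ VM[n, r]),
        𝔭 ≤ (VM[n, r]).comap (algebraMap B ↥VR[n, r]) ∧
          (VM[n, r]).map (algebraMap ↥VR[n, r] (Localization.Away g)) ≤
            𝔭.map ((algebraMap ↥VR[n, r] (Localization.Away g)).comp (algebraMap B ↥VR[n, r]))) :
    Scheme.HasResolution X := by
  refine IsolatedGlue.hasResolution_of_finite_singularLocus_of_local k X f hfin fun s hs => ?_
  obtain ⟨n, r, hn, hr, B, _, _, _, _, _, _, _, ι, _, hι, 𝔭, h𝔭, h𝔭0, hιs, hregB, g, hg, hover, hle⟩ :=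
    hchart s hs
  subst hιs
  have hr1 : 1 ≤ r := by omega
  haveI : (VM[n, r]).IsPrime := (vertexIdeal_isMaximal k n r hr1).isPrime
  exact PointBlowupEtale.hloc_of_pointBlowup_flat_chart_away k X f ι hι 𝔭 h𝔭0 hs hregB (VM[n, r]) hover
    g hg hle (veroneseCone_isRegular_affineBlowup k n r hr1)

end VeroneseEtale

end Cones

end Summit.ResolutionOfSingularities.ResolutionOfSingularities.Theorems.FRationalResolution

end
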